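import Summits.HodgeConjecture.HodgeConjecture.Theses.PadicSemiregularLift
import Summits.HodgeConjecture.HodgeConjecture.Theorems.FormalVectorBundlesAlgebraize.Negative.TowerTightness
import Literature.AlgebraicGeometry.KTheory.PullbackVectorBundle
import Literature.AlgebraicGeometry.Resolution.ChowLemmaRing

/-!
# Line `chow-frame-descent` — skeleton for crux `FormalVectorBundlesAlgebraize` (stmt-HodgeConjecture-14106)

Route `PadicSemiregularLift`, crux P3a `FormalVectorBundlesAlgebraize` (auto-crux, rank 9): for `k`
perfect of characteristic `p`, `𝒳/W(k)` a smooth proper model (`IsSmoothProperModel d 𝒳`) and a module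
`E₁` on the special fibre `X_k`, `LiftsFormally 𝒳 E₁ → LiftsTo 𝒳 E₁` (Grothendieck existence for
VECTOR BUNDLES; EGA III₁ 5.1.4 + Görtz–Wedhorn II 24.95/24.96 in print).

Idea `chow-frame-descent` (`Cruxes/FormalVectorBundlesAlgebraize/Ideas/chow-frame-descent.md`; triage
r1-1/2/3: pass ×3, merged with `chow-zariski-pushforward` ≈ `chow-stein-pushforward-descent` into the
FRAME lever, to be run after the projective ENGINE of `twist-presentation-completeness` ≈
`flat-ladder-graded-limit` ≈ `flat-tower-uniform-serre`). ONE LINE (all three triagers): take a Chow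
cover `π : Z → 𝒳` (`Z` integral, closed in `ℙᴺ_W`, `W`-flat, `π` proper birational), run the ENGINE on
the `W`-flat projective `Z` to algebraize the pulled-back tower `π_{n+1}^* E n` to a vector bundle `G`
on `Z`, and DESCEND THROUGH FRAMES: `𝒳` is normal (smooth over `W`), so `π_* 𝒪_Z = 𝒪_𝒳`, and one
level of the tower beyond the exponent `c` of the `p^∞`-torsion of the finite module `Ȟ¹(Z_A, G)`
makes a formal frame of `G` algebraic over each affine `Spec A ⊆ 𝒳`; hence `π_* G` is a vector bundle
on `𝒳` with `(π_* G)|_{X_1} ≅ E 0`, which is `LiftsTo`.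

## Registered stubs (5)

* `stub_chowCoverFlat` [M] — Chow cover of a smooth proper model with the extras the line consumes:
  `Z` projective over `W` (`ChowLemmaRing.IsProjOver`), `W`-FLAT, integral, `π` proper surjective and an
  isomorphism over a dense open (tree: `ChowLemmaRing.chow_proper` — needs `IsIntegral 𝒳.left`, to be
  derived from `IsSmoothProperModel` as in `GoodReductionZariskiProofs.isIntegral_total` — and
  `ZariskiChow.flat_of_isIntegral_of_surjective` over the DVR `W(k)`).
* `stub_directImageStructureSheaf` [M] — (N) `π_* 𝒪_Z = 𝒪_𝒳` for such a cover: smooth over the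
  regular `W` ⇒ regular ⇒ normal stalks, then Stacks 0AY8 (tree `TowardsNormal.isIso_app`,
  `bijective_app`; card `chow-zariski-pushforward`'s `ChowCoverFunctions`, verbatim).
* `stub_isFiniteLocallyFree_of_isVectorBundle` [S–M] — the bridge `IsVectorBundle → IsFiniteLocallyFree`
  (Mathlib `IsLocallyFree ∧ IsFiniteType` ⇒ Stacks 01C6 (2) with finite index sets; the tree has only the
  converse `IsFiniteLocallyFree.isVectorBundle`). Used HERE to pull the formal tower back to `Z`
  (`IsFiniteLocallyFree.pullback`), and by the provers of the two big stubs to get local frames.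
* `stub_projectiveFlatEngine` [XL, TRANSFER = the ENGINE, sister cards; HARDEST] — strong Grothendieck
  existence for formal vector bundles on a `W`-flat closed `Z ⊆ ℙᴺ_W`, level-wise `Nonempty` form
  (= `IdeatorTwoSketch.ProjectiveFlatEngineStrong` verbatim): flat `p`-adic ladder ⇒ ONE Serre bound on
  `ℙᴺ_k` ⇒ compatible twist presentations ⇒ coefficientwise limit in `W[x]_b` ⇒ cokernel ⇒ Krull + 24.96.
* `stub_frameDescent` [L, the card's First lemma at level `0`; the NEW content of this line] — for
  `𝒳` proper over `W`, `π : Z → 𝒳` over `W` with `Z` projective `W`-flat, `π` proper and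
  `π_* 𝒪_Z = 𝒪_𝒳`, a vector bundle `G` on `Z` with `G|_{Z_{n+1}} ≅ π_{n+1}^* E n` for all `n` along a
  formal tower `(E n)` of vector bundles on `𝒳`: `π_* G` is a vector bundle and `(π_* G)|_{X_1} ≅ E 0`
  (one-level frame lifting with a UNIFORM level `c + 1` over a finite affine cover, triage r1-1/r1-2
  sharpenings; no completion of `A`, no Mittag-Leffler, no `lim¹ Aut` re-choice).

PROVED here (no `sorry`): the naturality of the tower maps under base change of a `W`-morphism
(`thickeningHom_comp_thickeningι`, `thickeningHom_comp_hom`, `thickeningMap_hom`,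
`thickeningMap_thickeningHom`, `pullbackTowerIso`), the composition in implication form `smoothModelExistenceVB_of_stubs :
S1 → S2 → S3 → S4 → S5 → SmoothModelExistenceVB` (kernel-checked), and — the ONLY theorem of this
file concluding the crux, BY NAME and hypothesis-free — `FormalVectorBundlesAlgebraize_of`
(`sorryAx` enters only through the five `stub_*`).

DISPROOF USED (`Cruxes/FormalVectorBundlesAlgebraize/Disproof.lean`: cycle 1 read in full before
drafting; CYCLE 2 (published 2026-08-16T04:05Z, §§5–8, all new theorems sorry-free) read at the
publishing boundary): `crux_of_grothendieckExistenceVB` is the shape of the final glue, and the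
composition target `SmoothModelExistenceVB` below is VERBATIM the right-hand side of cycle 2's
`crux_iff_levelOne` (so it carries no slack: the crux is EQUIVALENT to it); §8(a) pre-pick audit: the
typed ancestors of `stub_directImageStructureSheaf` (`ChowCoverFunctions`), `stub_projectiveFlatEngine`
(`ProjectiveFlatEngineStrong`) and `stub_frameDescent` (`pushforward_isVectorBundle_of_formally_descended`
/ `PushforwardTransport`) are TRUE AS TYPED — its "hidden use" (compatible RE-CHOICE of the level-wise
isos, `lim¹ Aut = *` on proper thickenings) is NOT needed on this line: `stub_frameDescent` is proved
from ONE global level-`(c+1)` isomorphism (uniform `c`), never re-choosing (triage r1-1/r1-2); §7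
`not_restrictSpecialFaithful` honoured (no morphism is descended from `X_k`; the comparison lives on
`X_1` and is built from level `c+1`); §5 (`X_k ≅ X_1` for perfect `k`) unused; `not_withoutProper` honoured — properness of `𝒳` is used at
`stub_chowCoverFlat` (Chow over `Spec W`, projectivity of `Z`) and at `stub_frameDescent` (`Z_A ↪ ℙᴺ_A`
closed, Serre finiteness, "an open neighbourhood of `X_k` is `𝒳`" = GW II 24.96); `not_withoutLiftsFormally`
honoured — the whole tower is consumed (`stub_projectiveFlatEngine` on `π^*` of it, all levels in the
hypothesis of `stub_frameDescent`); tightness `liftsFormally_of_algebraicLift` respected (no stub claims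
more than level-wise `Nonempty` isomorphisms); the refuted strengthening `UniqueAlgebraization` is
neither asserted nor used (`π_* G` algebraizes the CHOSEN tower); mutation finding `crux_of_properOnly`:
this line deliberately SPENDS smoothness (normality, at `stub_directImageStructureSheaf`) and proves the
crux as typed, not `ProperOnly`. Landed Negative lemmas: `Theorems/FormalVectorBundlesAlgebraize/Negative/TowerTightness`
(imported; bookkeeping + tightness only, its `thickeningMap_snd` is reused) — no stub is an instance of
a refuted statement (`ledger negatives --problem HodgeConjecture`: 2 unrelated entries).
-/

set_option linter.dupNamespace false

noncomputable section

namespace Summit.HodgeConjecture.HodgeConjecture.Cruxes.FormalVectorBundlesAlgebraize.ChowFrameDescent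

open CategoryTheory AlgebraicGeometry Limits
open Literature.AlgebraicGeometry.Motives Literature.AlgebraicGeometry.Motives.WittScheme
open Literature.AlgebraicGeometry.Resolution
open Summit.HodgeConjecture.HodgeConjecture.Theses.PadicSemiregularLift (FormalVectorBundlesAlgebraize)
open Summit.HodgeConjecture.HodgeConjecture.Theorems.FormalVectorBundlesAlgebraize.Negative
  (thickeningMap_snd)

universe u

/-! ## The five registered stubs -/

/-- **stub_chowCoverFlat** (size M). A smooth proper model `𝒳/W(k)` (`k` perfect of characteristic `p`)
admits a CHOW COVER WITH THE EXTRAS THE LINE CONSUMES: a `W`-scheme `Z` with a closed `W`-immersion into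
some `ℙᴺ_W` (`ChowLemmaRing.IsProjOver Z`), FLAT over `W`, INTEGRAL, and a `W`-morphism `π : Z ⟶ 𝒳`
that is proper, surjective and an isomorphism over a dense open `U ⊆ 𝒳`.
Paper proof: `𝒳` is integral — reduced because smooth over the reduced `Spec W`
(`Resolution.isReduced_of_smooth_of_isReduced_base`), irreducible because `𝒳 → Spec W` is flat hence
universally open and the generic fibre `X_K` is (geometrically) irreducible
(`ZariskiChow.irreducibleSpace_of_genericFibre`, `IsSmoothProperModel.isSmoothProjective_genericFibre`),
non-empty because `X_K` is; Chow's lemma over `Spec W` for the proper integral `𝒳`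
(`ChowLemmaRing.chow_proper`: `X'` integral, `ι : X' ↪ ℙᴺ_W` closed, `π` proper surjective,
`ι ≫ pr = π ≫ 𝒳.hom`, iso over a dense open); `Z := Over.mk (π ≫ 𝒳.hom)`; `Z → Spec W` is surjective
(both fibres of `𝒳` are non-empty, `π` surjective) from an integral scheme onto the spectrum of the
discrete valuation ring `W(k)` (`WittVector.isDiscreteValuationRing`), hence flat
(`ZariskiChow.flat_of_isIntegral_of_surjective`, Hartshorne III 9.7).
Sources: GortzWedhorn2020 Thm 13.100; StacksProject 02O2; Hartshorne1977 II Ex. 4.10, III Prop. 9.7. -/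
theorem stub_chowCoverFlat :
    ∀ (p : ℕ) [Fact p.Prime] (k : Type) [Field k] [CharP k p] [PerfectRing k p] (d : ℕ)
      (𝒳 : SchemeOver (WittVector p k)), IsSmoothProperModel d 𝒳 →
      ∃ (Z : SchemeOver (WittVector p k)) (π : Z ⟶ 𝒳),
        ChowLemmaRing.IsProjOver Z ∧ Flat Z.hom ∧ IsIntegral Z.left ∧ IsProper π.left ∧
          Surjective π.left ∧
          ∃ U : 𝒳.left.Opens, Dense (U : Set 𝒳.left) ∧ IsIso (π.left ∣_ U) := by
  sorry

/-- **stub_directImageStructureSheaf** (size M; (N) of the card = `ChowCoverFunctions` of card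
`chow-zariski-pushforward`). For a smooth proper model `𝒳/W(k)` and a proper surjective `π : Z → 𝒳` from
an INTEGRAL scheme which is an isomorphism over a dense open, pulling back functions is bijective on
every open: `π_* 𝒪_Z = 𝒪_𝒳`.
Paper proof (Stacks 0AY8): `𝒳` is integral (as in `stub_chowCoverFlat`) with integrally closed local
rings (smooth over the regular `W(k)` ⇒ regular ⇒ normal: tree
`isRegularLocalRing_stalk_of_smoothOfRelativeDimension_specOfRegular`,
`isIntegrallyClosed_of_isRegularLocalRing`); the generic point of `Z` lies in the non-empty open `π⁻¹U`,
which maps isomorphically to `U ∋ ξ`, so it lies over the generic point `ξ` of `𝒳` and the generic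
fibre of `π` is `Spec κ(ξ)`; conclude by `TowardsNormal.isIso_app` (`SteinFactorizationProofs`; its
hypotheses: universally closed ✓, `𝒳` integral with integrally closed stalks ✓, `Z` reduced ✓, generic
points over `ξ` ✓, `H⁰(Z_ξ, 𝒪) = κ(ξ)` ✓). Empty opens are harmless (both sides are the zero ring).
Sources: StacksProject 0AY8, 033C; Hartshorne1977 III Cor. 11.4. -/
theorem stub_directImageStructureSheaf :
    ∀ (p : ℕ) [Fact p.Prime] (k : Type) [Field k] [CharP k p] [PerfectRing k p] (d : ℕ)
      (𝒳 : SchemeOver (WittVector p k)), IsSmoothProperModel d 𝒳 →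
      ∀ (Z : Scheme.{0}) (π : Z ⟶ 𝒳.left), IsIntegral Z → IsProper π → Surjective π →
        (∃ U : 𝒳.left.Opens, Dense (U : Set 𝒳.left) ∧ IsIso (π ∣_ U)) →
        ∀ U : 𝒳.left.Opens, Function.Bijective (π.app U) := by
  sorry

/-- **stub_isFiniteLocallyFree_of_isVectorBundle** (size S–M; the bridge the tree lacks, cf. Disproof
§3). A vector bundle in the sense of `Motives.IsVectorBundle` (Mathlib `SheafOfModules.IsLocallyFree ∧
IsFiniteType`, Stacks 01C6 (1) + 01B5) is finite locally free in the sense of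
`Motives.IsFiniteLocallyFree` (Stacks 01C6 (2): near every point `E|_U ≅ 𝒪_U^I` with `I` FINITE).
Paper proof: at `x`, `E|_{U} ≅ 𝒪^{(I)}` on some `U ∋ x` (locally free data, transported to `E.over U` as
in `KTheory/PullbackVectorBundle.nonempty_overIso_of_restrictIso`) and `E|_V` is generated by finitely
many sections on some `V ∋ x`; on an affine `W ⊆ U ∩ V` containing `x` the epimorphism
`𝒪_W^m ↠ E|_W ≅ 𝒪_W^{(I)}` gives, at the (non-zero) residue field of `x`, a surjection `κ(x)^m ↠ κ(x)^{(I)}`,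
so `I` is finite. The converse is the tree's `IsFiniteLocallyFree.isVectorBundle`.
Sources: StacksProject 01C6, 01C8; Hartshorne1977 II.5. -/
theorem stub_isFiniteLocallyFree_of_isVectorBundle :
    ∀ (X : Scheme.{u}) (E : X.Modules), IsVectorBundle E → IsFiniteLocallyFree E := by
  sorry

/-- **stub_projectiveFlatEngine** (size XL; the TRANSFER stub = the projective ENGINE of the sister
cards `twist-presentation-completeness` ≈ `flat-ladder-graded-limit` ≈ `flat-tower-uniform-serre`, in
the STRONG, level-wise-`Nonempty` form the frame consumes; verbatim
`IdeatorTwoSketch.ProjectiveFlatEngineStrong`). For `Z` a closed `W`-subscheme of some `ℙᴺ_W`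
(`ChowLemmaRing.IsProjOver Z`) that is FLAT over `W = W(k)`, every tower `(F n)` of vector bundles on
the thickenings `Z_{n+1} = Z ⊗ W/pⁿ⁺¹` with `F (n+1)|_{Z_{n+1}} ≅ F n` is, level-wise, the restriction
of ONE vector bundle `G` on `Z`.
Paper proof (EGA III₁ 5.1.4 on the projective flat `Z`, rebuilt without GW II 24.39/24.100): choose
the transition isomorphisms; push the levels into `ℙᴺ_{W_{n+1}}` (`W_{n+1}`-flat coherent, constant
graded pieces `pⁿF/pⁿ⁺¹F ≅ F₀` by flatness) so that the ladder `0 → F₀ → F_{n+1} → F_n → 0` and ONE pair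
of Serre bounds (A + B) for `F₀`, `K₀` on `ℙᴺ_k` lift generators and relations through the whole tower;
`Hom(𝒪(−m′)^s, 𝒪(−m)^r)` on `ℙᴺ_{W_n}` is `Mat(W_n[x]_{m′−m})`, so the compatible presentation
matrices converge coefficientwise in the finite free `W`-module `W[x]_{m′−m}`
(`WittVector.isAdicCompleteIdealSpanP`); `G := ι^* coker(u)`, `G|_{Z_{n+1}} ≅ F n` by right-exactness
of pull-back; `G` is locally free along `Z_k` by Krull / the local flatness criterion and everywhere
because `Z → Spec W` is closed (GW II 24.96). Shared hardest sub-step (all triagers): the dictionary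
"coherent sheaf on `ℙᴺ_A` = `(M/K)~` for finite graded modules, Čech = LaurentCech degreewise"
(`Morphisms/CechH1Projective*`, `Algebra/Homology/LaurentCech*`, `ProjTwist*`).
Sources: EGAIII1 Thm 5.1.4, §5.2; GortzWedhorn2023 Thm 24.94, Prop 24.95, Lemma 24.96; StacksProject
0886, 02OB; Hartshorne1977 III 5.2, II 5.15–5.17. -/
theorem stub_projectiveFlatEngine :
    ∀ (p : ℕ) [Fact p.Prime] (k : Type) [Field k] [CharP k p] [PerfectRing k p]
      (Z : SchemeOver (WittVector p k)), ChowLemmaRing.IsProjOver Z → Flat Z.hom →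
      ∀ (F : ∀ n : ℕ, (thickening Z (n + 1)).left.Modules), (∀ n, IsVectorBundle (F n)) →
        (∀ n, Nonempty ((Scheme.Modules.pullback (thickeningMap Z (Nat.le_succ (n + 1)))).obj
          (F (n + 1)) ≅ F n)) →
        ∃ G : Z.left.Modules, IsVectorBundle G ∧
          ∀ n, Nonempty ((Scheme.Modules.pullback (thickeningι Z (n + 1))).obj G ≅ F n) := by
  sorry

/-- **stub_frameDescent** (size L; the card's First lemma, level-`0` conjunct — the LEVER (N)+(L)).
Let `𝒳` be proper over `W = W(k)`, `π : Z ⟶ 𝒳` a `W`-morphism with `Z` projective and FLAT over `W`,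
`π` proper and `π_* 𝒪_Z = 𝒪_𝒳` (all `π^* : 𝒪_𝒳(U) → 𝒪_Z(π⁻¹U)` bijective), `(E n)` a tower of vector
bundles on the thickenings `X_{n+1}` with `E (n+1)|_{X_{n+1}} ≅ E n`, and `G` a vector bundle on `Z` with
`G|_{Z_{n+1}} ≅ π_{n+1}^* E n` for EVERY `n` (`π_{n+1} = π ⊗ W/pⁿ⁺¹`). Then `π_* G` is a vector bundle on
`𝒳` and `(π_* G)|_{X_1} ≅ E 0`.
Paper proof. Cover `𝒳` by finitely many affines `Spec A` on which `E 0` is free (rank `e`); then every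
`E n|_{(Spec A)_{n+1}}` is free (a finite projective `A/pⁿ⁺¹`-module free mod `p` is free; the tower isos
give `E n|_{X_1} ≅ E 0`, `Negative.TowerTightness.nonempty_pullback_iso_of_tower`), so `G|_{Z_{A,n+1}}`
has a frame `φ_n` for every `n`. `A` is Noetherian, `Z_A := π⁻¹ Spec A ↪ ℙᴺ_A` is closed (`𝒳 → Spec W`
separated), so `H := Ȟ¹(Z_A, G)` is a finite `A`-module (tree: `Devissage.devissage` +
`DevissageHeart.heart_holds`, or `ProjCech.moduleFinite_cechH1`-style Serre finiteness) and `p^c` kills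
`H[p^∞]` for some `c`, uniform over the finite cover. (L) ONE-LEVEL LIFTING: `p` is regular on `G`
(`Z` is `W`-flat, `G` locally free), the Bockstein sequences `0 → G →(p^N) G → G/p^N → 0` for `N = c+1`
and `N = 1` are linked by `(p^c, id, red)`, so `δ₁ ∘ red = p^c · δ_N` with `p^N δ_N = 0`; hence the
reduction mod `p` of `φ_c` lies in `ker δ₁ = im (Γ(Z_A, G) → Γ(Z_{A,1}, G/p))` and LIFTS to an
algebraic `σ : 𝒪^e → G|_{Z_A}` (this is the mechanism of the tree's
`FormalFunctionsCechProofs.hasSurjectiveFormalFunctions_of_finite_cechH1`, whose `[Flat f]` enters only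
through `p`-regularity of sections; abstract form = `IdeatorOneSketch.reduction_lifts_of_torsion_exponent`,
closed by the triagers in 3 lines). `σ` is an iso mod `p`, hence (Nakayama / determinant) an iso on an
open `V ⊇ π⁻¹V(p)`, hence over an open `V' ⊆ Spec A` containing `V(p)` (`π` closed), where
`π_* G ≅ (π_* 𝒪_Z)^e = 𝒪^e` by (N). So `π_* G` is free of finite rank on a neighbourhood of `X_k`, which
is all of `𝒳` (`𝒳 → Spec W` closed, `W` local: GW II Lemma 24.96). LEVEL `0`: the comparison
`(π_* G)|_{X_1} → π_{1*}(G|_{Z_1}) ≅ π_{1*}π_1^* E 0 ⊇ E 0` built from the SAME level-`(c+1)` iso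
(reduced mod `p`, then the tower iso `E c|_{X_1} ≅ E 0`) identifies both sides with the `A/p`-span of
the frame inside `Γ(Z_{A,1}, 𝒪)^e ⊇ (A/p)^e` (`A/p = Γ(Z_A,𝒪)/p ↪ Γ(Z_{A,1},𝒪)` by (N) and
`p`-regularity); these local identifications are restrictions of global sheaf maps, so they glue
(triage r1-1/r1-2 sharpenings: uniform level, level `0` only, no `lim¹ Aut`).
Sources: StacksProject 02OB (3)/02OC, 0AY8, 01C8; GortzWedhorn2023 Lemma 24.96, Prop 24.95,
Lemma 24.103 with the remark p. 573; EGAIII1 Thm 4.1.5; Hartshorne1977 III 11.1, III 5.2 (a). -/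
theorem stub_frameDescent :
    ∀ (p : ℕ) [Fact p.Prime] (k : Type) [Field k] [CharP k p] [PerfectRing k p]
      (𝒳 : SchemeOver (WittVector p k)), IsProper 𝒳.hom →
      ∀ (Z : SchemeOver (WittVector p k)) (π : Z ⟶ 𝒳), ChowLemmaRing.IsProjOver Z → Flat Z.hom →
        IsProper π.left → (∀ U : 𝒳.left.Opens, Function.Bijective (π.left.app U)) →
        ∀ (G : Z.left.Modules), IsVectorBundle G →
        ∀ (E : ∀ n : ℕ, (thickening 𝒳 (n + 1)).left.Modules), (∀ n, IsVectorBundle (E n)) →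
          (∀ n, Nonempty ((Scheme.Modules.pullback (thickeningMap 𝒳 (Nat.le_succ (n + 1)))).obj
            (E (n + 1)) ≅ E n)) →
          (∀ n, Nonempty ((Scheme.Modules.pullback (thickeningι Z (n + 1))).obj G ≅
            (Scheme.Modules.pullback
              ((baseChange (WittVector p k) (wittQuot p k (n + 1))).map π).left).obj (E n))) →
          IsVectorBundle ((Scheme.Modules.pushforward π.left).obj G) ∧
            Nonempty ((Scheme.Modules.pullback (thickeningι 𝒳 1)).obj
              ((Scheme.Modules.pushforward π.left).obj G) ≅ E 0) := by
  sorry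

/-! ## Tower maps under base change of a `W`-morphism (proved) -/

section Naturality

variable {p : ℕ} [Fact p.Prime] {k : Type u} [CommRing k] {Z 𝒳 : SchemeOver (WittVector p k)}
  (π : Z ⟶ 𝒳)

/-- `π_n : Z_n ⟶ X_n`, the base change of the `W`-morphism `π` to `W_n = W/pⁿ` on underlying schemes,
with source and target SPELT as thickenings (reducible abbreviation of
`((baseChange W W_n).map π).left`, which is how the stubs state it). -/
abbrev thickeningHom (n : ℕ) : (thickening Z n).left ⟶ (thickening 𝒳 n).left :=
  ((baseChange (WittVector p k) (wittQuot p k n)).map π).left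

/-- `Z_n ⟶ X_n ⟶ 𝒳` is `Z_n ⟶ Z ⟶ 𝒳` (first projections of the fibre products). -/
@[reassoc]
theorem thickeningHom_comp_thickeningι (n : ℕ) :
    thickeningHom π n ≫ thickeningι 𝒳 n = thickeningι Z n ≫ π.left :=
  pullback.lift_fst _ _ _

/-- `Z_n ⟶ X_n ⟶ Spec W_n` is the structure morphism of `Z_n`. -/
@[reassoc]
theorem thickeningHom_comp_hom (n : ℕ) :
    thickeningHom π n ≫ (thickening 𝒳 n).hom = (thickening Z n).hom :=
  Over.w _

/-- `X_m ⟶ X_n ⟶ Spec W_n` is `X_m ⟶ Spec W_m ⟶ Spec W_n` (`Negative.TowerTightness.thickeningMap_snd`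
in structure-morphism form). -/
@[reassoc]
theorem thickeningMap_hom (𝒴 : SchemeOver (WittVector p k)) {m n : ℕ} (h : m ≤ n) :
    thickeningMap 𝒴 h ≫ (thickening 𝒴 n).hom =
      (thickening 𝒴 m).hom ≫ Spec.map (CommRingCat.ofHom (Ideal.Quotient.factor
        (Ideal.pow_le_pow_right (I := Ideal.span {(p : WittVector p k)}) h))) :=
  thickeningMap_snd 𝒴 h

/-- **Naturality of the tower**: `Z_m ⟶ Z_n ⟶ X_n` is `Z_m ⟶ X_m ⟶ X_n`. (The objects
`(thickening _ n).left` are fibre products only up to `def` unfolding, so the two components are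
compared by explicit `calc` chains through the projections, as in `Negative.TowerTightness`.) -/
@[reassoc]
theorem thickeningMap_thickeningHom {m n : ℕ} (h : m ≤ n) :
    thickeningMap Z h ≫ thickeningHom π n = thickeningHom π m ≫ thickeningMap 𝒳 h := by
  apply pullback.hom_ext
  · have e₁ : (thickeningMap Z h ≫ thickeningHom π n) ≫ thickeningι 𝒳 n = thickeningι Z m ≫ π.left :=
      calc (thickeningMap Z h ≫ thickeningHom π n) ≫ thickeningι 𝒳 n
          = thickeningMap Z h ≫ (thickeningHom π n ≫ thickeningι 𝒳 n) := Category.assoc _ _ _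
        _ = thickeningMap Z h ≫ (thickeningι Z n ≫ π.left) :=
            congrArg (thickeningMap Z h ≫ ·) (thickeningHom_comp_thickeningι π n)
        _ = (thickeningMap Z h ≫ thickeningι Z n) ≫ π.left := (Category.assoc _ _ _).symm
        _ = thickeningι Z m ≫ π.left := congrArg (· ≫ π.left) (thickeningMap_ι Z h)
    have e₂ : (thickeningHom π m ≫ thickeningMap 𝒳 h) ≫ thickeningι 𝒳 n = thickeningι Z m ≫ π.left :=
      calc (thickeningHom π m ≫ thickeningMap 𝒳 h) ≫ thickeningι 𝒳 n
          = thickeningHom π m ≫ (thickeningMap 𝒳 h ≫ thickeningι 𝒳 n) := Category.assoc _ _ _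
        _ = thickeningHom π m ≫ thickeningι 𝒳 m := congrArg (thickeningHom π m ≫ ·) (thickeningMap_ι 𝒳 h)
        _ = thickeningι Z m ≫ π.left := thickeningHom_comp_thickeningι π m
    exact e₁.trans e₂.symm
  · have e₁ : (thickeningMap Z h ≫ thickeningHom π n) ≫ (thickening 𝒳 n).hom =
        (thickening Z m).hom ≫ Spec.map (CommRingCat.ofHom (Ideal.Quotient.factor
          (Ideal.pow_le_pow_right (I := Ideal.span {(p : WittVector p k)}) h))) :=
      calc (thickeningMap Z h ≫ thickeningHom π n) ≫ (thickening 𝒳 n).hom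
          = thickeningMap Z h ≫ (thickeningHom π n ≫ (thickening 𝒳 n).hom) := Category.assoc _ _ _
        _ = thickeningMap Z h ≫ (thickening Z n).hom :=
            congrArg (thickeningMap Z h ≫ ·) (thickeningHom_comp_hom π n)
        _ = (thickening Z m).hom ≫ Spec.map (CommRingCat.ofHom (Ideal.Quotient.factor
              (Ideal.pow_le_pow_right (I := Ideal.span {(p : WittVector p k)}) h))) :=
            thickeningMap_hom Z h
    have e₂ : (thickeningHom π m ≫ thickeningMap 𝒳 h) ≫ (thickening 𝒳 n).hom =
        (thickening Z m).hom ≫ Spec.map (CommRingCat.ofHom (Ideal.Quotient.factor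
          (Ideal.pow_le_pow_right (I := Ideal.span {(p : WittVector p k)}) h))) :=
      calc (thickeningHom π m ≫ thickeningMap 𝒳 h) ≫ (thickening 𝒳 n).hom
          = thickeningHom π m ≫ (thickeningMap 𝒳 h ≫ (thickening 𝒳 n).hom) := Category.assoc _ _ _
        _ = thickeningHom π m ≫ ((thickening 𝒳 m).hom ≫ Spec.map (CommRingCat.ofHom
              (Ideal.Quotient.factor
                (Ideal.pow_le_pow_right (I := Ideal.span {(p : WittVector p k)}) h)))) :=
            congrArg (thickeningHom π m ≫ ·) (thickeningMap_hom 𝒳 h)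
        _ = (thickeningHom π m ≫ (thickening 𝒳 m).hom) ≫ Spec.map (CommRingCat.ofHom
              (Ideal.Quotient.factor
                (Ideal.pow_le_pow_right (I := Ideal.span {(p : WittVector p k)}) h))) :=
            (Category.assoc _ _ _).symm
        _ = (thickening Z m).hom ≫ Spec.map (CommRingCat.ofHom (Ideal.Quotient.factor
              (Ideal.pow_le_pow_right (I := Ideal.span {(p : WittVector p k)}) h))) :=
            congrArg (· ≫ Spec.map (CommRingCat.ofHom (Ideal.Quotient.factor
              (Ideal.pow_le_pow_right (I := Ideal.span {(p : WittVector p k)}) h))))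
              (thickeningHom_comp_hom π m)
    exact e₁.trans e₂.symm

/-- The formal tower `(E n)` on `𝒳` pulls back along the `π_{n+1}` to a tower on `Z`: the transition
isomorphism at level `n` (pseudofunctoriality of `Scheme.Modules.pullback` + `thickeningMap_thickeningHom`). -/
def pullbackTowerIso (E : ∀ n : ℕ, (thickening 𝒳 (n + 1)).left.Modules) (n : ℕ)
    (e : (Scheme.Modules.pullback (thickeningMap 𝒳 (Nat.le_succ (n + 1)))).obj (E (n + 1)) ≅ E n) :
    (Scheme.Modules.pullback (thickeningMap Z (Nat.le_succ (n + 1)))).obj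
        ((Scheme.Modules.pullback (thickeningHom π (n + 1 + 1))).obj (E (n + 1))) ≅
      (Scheme.Modules.pullback (thickeningHom π (n + 1))).obj (E n) :=
  have i₁ : (Scheme.Modules.pullback (thickeningMap Z (Nat.le_succ (n + 1)))).obj
        ((Scheme.Modules.pullback (thickeningHom π (n + 1 + 1))).obj (E (n + 1))) ≅
      (Scheme.Modules.pullback (thickeningMap Z (Nat.le_succ (n + 1)) ≫ thickeningHom π (n + 1 + 1))).obj
        (E (n + 1)) :=
    (Scheme.Modules.pullbackComp (thickeningMap Z (Nat.le_succ (n + 1))) (thickeningHom π (n + 1 + 1))).app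
      (E (n + 1))
  have i₂ : (Scheme.Modules.pullback
        (thickeningMap Z (Nat.le_succ (n + 1)) ≫ thickeningHom π (n + 1 + 1))).obj (E (n + 1)) ≅
      (Scheme.Modules.pullback (thickeningHom π (n + 1) ≫ thickeningMap 𝒳 (Nat.le_succ (n + 1)))).obj
        (E (n + 1)) :=
    (Scheme.Modules.pullbackCongr (thickeningMap_thickeningHom π (Nat.le_succ (n + 1)))).app (E (n + 1))
  have i₃ : (Scheme.Modules.pullback
        (thickeningHom π (n + 1) ≫ thickeningMap 𝒳 (Nat.le_succ (n + 1)))).obj (E (n + 1)) ≅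
      (Scheme.Modules.pullback (thickeningHom π (n + 1))).obj
        ((Scheme.Modules.pullback (thickeningMap 𝒳 (Nat.le_succ (n + 1)))).obj (E (n + 1))) :=
    (Scheme.Modules.pullbackComp (thickeningHom π (n + 1)) (thickeningMap 𝒳 (Nat.le_succ (n + 1)))).symm.app
      (E (n + 1))
  i₁ ≪≫ i₂ ≪≫ i₃ ≪≫ (Scheme.Modules.pullback (thickeningHom π (n + 1))).mapIso e

end Naturality

/-! ## Composition -/

/-- **What the line proves** (cf. `Disproof.GrothendieckExistenceVB`, the all-proper form): on a
SMOOTH proper model every tower of vector bundles on the thickenings is, at level one, the restriction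
of a vector bundle on `𝒳`. Smoothness is spent (normality, `stub_directImageStructureSheaf`); the
line proves the crux as typed, not `Disproof.ProperOnly`. -/
def SmoothModelExistenceVB : Prop :=
  ∀ (p : ℕ) [Fact p.Prime] (k : Type) [Field k] [CharP k p] [PerfectRing k p] (d : ℕ)
    (𝒳 : SchemeOver (WittVector p k)), IsSmoothProperModel d 𝒳 →
    ∀ (E : ∀ n : ℕ, (thickening 𝒳 (n + 1)).left.Modules), (∀ n, IsVectorBundle (E n)) →
      (∀ n, Nonempty ((Scheme.Modules.pullback
        (thickeningMap 𝒳 (Nat.le_succ (n + 1)))).obj (E (n + 1)) ≅ E n)) →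
      ∃ F : 𝒳.left.Modules, IsVectorBundle F ∧
        Nonempty ((Scheme.Modules.pullback (thickeningι 𝒳 1)).obj F ≅ E 0)

/-- **Composition, implication form** (kernel-checked, no `sorry`): the five stub STATEMENTS imply
`SmoothModelExistenceVB`. Route: Chow cover (S1) ⟶ `π_* 𝒪_Z = 𝒪_𝒳` (S2) ⟶ pull the tower back to
the thickenings of `Z` (S3 + `IsFiniteLocallyFree.pullback`, transitions by `pullbackTowerIso`)
⟶ algebraize on `Z` (S4) ⟶ descend through frames (S5). (Stated with this conclusion so that exactly
ONE theorem of the file, `FormalVectorBundlesAlgebraize_of`, concludes the crux.) -/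
theorem smoothModelExistenceVB_of_stubs
    (h₁ : ∀ (p : ℕ) [Fact p.Prime] (k : Type) [Field k] [CharP k p] [PerfectRing k p] (d : ℕ)
      (𝒳 : SchemeOver (WittVector p k)), IsSmoothProperModel d 𝒳 →
      ∃ (Z : SchemeOver (WittVector p k)) (π : Z ⟶ 𝒳),
        ChowLemmaRing.IsProjOver Z ∧ Flat Z.hom ∧ IsIntegral Z.left ∧ IsProper π.left ∧
          Surjective π.left ∧
          ∃ U : 𝒳.left.Opens, Dense (U : Set 𝒳.left) ∧ IsIso (π.left ∣_ U))
    (h₂ : ∀ (p : ℕ) [Fact p.Prime] (k : Type) [Field k] [CharP k p] [PerfectRing k p] (d : ℕ)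
      (𝒳 : SchemeOver (WittVector p k)), IsSmoothProperModel d 𝒳 →
      ∀ (Z : Scheme.{0}) (π : Z ⟶ 𝒳.left), IsIntegral Z → IsProper π → Surjective π →
        (∃ U : 𝒳.left.Opens, Dense (U : Set 𝒳.left) ∧ IsIso (π ∣_ U)) →
        ∀ U : 𝒳.left.Opens, Function.Bijective (π.app U))
    (h₃ : ∀ (X : Scheme.{0}) (E : X.Modules), IsVectorBundle E → IsFiniteLocallyFree E)
    (h₄ : ∀ (p : ℕ) [Fact p.Prime] (k : Type) [Field k] [CharP k p] [PerfectRing k p]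
      (Z : SchemeOver (WittVector p k)), ChowLemmaRing.IsProjOver Z → Flat Z.hom →
      ∀ (F : ∀ n : ℕ, (thickening Z (n + 1)).left.Modules), (∀ n, IsVectorBundle (F n)) →
        (∀ n, Nonempty ((Scheme.Modules.pullback (thickeningMap Z (Nat.le_succ (n + 1)))).obj
          (F (n + 1)) ≅ F n)) →
        ∃ G : Z.left.Modules, IsVectorBundle G ∧
          ∀ n, Nonempty ((Scheme.Modules.pullback (thickeningι Z (n + 1))).obj G ≅ F n))
    (h₅ : ∀ (p : ℕ) [Fact p.Prime] (k : Type) [Field k] [CharP k p] [PerfectRing k p]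
      (𝒳 : SchemeOver (WittVector p k)), IsProper 𝒳.hom →
      ∀ (Z : SchemeOver (WittVector p k)) (π : Z ⟶ 𝒳), ChowLemmaRing.IsProjOver Z → Flat Z.hom →
        IsProper π.left → (∀ U : 𝒳.left.Opens, Function.Bijective (π.left.app U)) →
        ∀ (G : Z.left.Modules), IsVectorBundle G →
        ∀ (E : ∀ n : ℕ, (thickening 𝒳 (n + 1)).left.Modules), (∀ n, IsVectorBundle (E n)) →
          (∀ n, Nonempty ((Scheme.Modules.pullback (thickeningMap 𝒳 (Nat.le_succ (n + 1)))).obj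
            (E (n + 1)) ≅ E n)) →
          (∀ n, Nonempty ((Scheme.Modules.pullback (thickeningι Z (n + 1))).obj G ≅
            (Scheme.Modules.pullback
              ((baseChange (WittVector p k) (wittQuot p k (n + 1))).map π).left).obj (E n))) →
          IsVectorBundle ((Scheme.Modules.pushforward π.left).obj G) ∧
            Nonempty ((Scheme.Modules.pullback (thickeningι 𝒳 1)).obj
              ((Scheme.Modules.pushforward π.left).obj G) ≅ E 0)) :
    SmoothModelExistenceVB := by
  intro p _ k _ _ _ d 𝒳 h𝒳 E hE hstep
  -- S1: the Chow cover, S2: `π_* 𝒪_Z = 𝒪_𝒳`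
  obtain ⟨Z, π, hZproj, hZflat, hZint, hπproper, hπsurj, hU⟩ := h₁ p k d 𝒳 h𝒳
  have hπO : ∀ U : 𝒳.left.Opens, Function.Bijective (π.left.app U) :=
    h₂ p k d 𝒳 h𝒳 Z.left π.left hZint hπproper hπsurj hU
  -- the pulled-back tower `F n := π_{n+1}^* E n` on the thickenings of `Z` (S3 for vector-bundle-ness)
  have hF : ∀ n, IsVectorBundle ((Scheme.Modules.pullback (thickeningHom π (n + 1))).obj (E n)) :=
    fun n => ((h₃ _ (E n) (hE n)).pullback _).isVectorBundle
  have hFstep : ∀ n, Nonempty ((Scheme.Modules.pullback (thickeningMap Z (Nat.le_succ (n + 1)))).obj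
      ((Scheme.Modules.pullback (thickeningHom π (n + 1 + 1))).obj (E (n + 1))) ≅
      (Scheme.Modules.pullback (thickeningHom π (n + 1))).obj (E n)) :=
    fun n => (hstep n).map (pullbackTowerIso π E n)
  -- S4: algebraize on `Z`; S5: descend through frames
  obtain ⟨G, hG, hGF⟩ := h₄ p k Z hZproj hZflat
    (fun n => (Scheme.Modules.pullback (thickeningHom π (n + 1))).obj (E n)) hF hFstep
  obtain ⟨hVB, hiso⟩ :=
    h₅ p k 𝒳 h𝒳.isProper Z π hZproj hZflat hπproper hπO G hG E hE hstep hGF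
  exact ⟨_, hVB, hiso⟩

/-- **Composition** — the ONLY theorem of this file concluding the crux, and it does so BY NAME,
hypothesis-free, from the five registered stubs by name (no `sorry` of its own; `sorryAx` enters only
through `stub_chowCoverFlat`, `stub_directImageStructureSheaf`,
`stub_isFiniteLocallyFree_of_isVectorBundle`, `stub_projectiveFlatEngine`, `stub_frameDescent`): the
level-one algebraization restricts to `E₁` along `X_k ⟶ X_1 ⟶ 𝒳 = X_k ⟶ 𝒳`
(`specialFibreToThickening_ι`; the glue `liftsTo_of_levelOne` of `IdeatorTwoSketch` /
`Disproof.crux_of_grothendieckExistenceVB`). -/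
theorem FormalVectorBundlesAlgebraize_of : FormalVectorBundlesAlgebraize := by
  intro p _ k _ _ _ d 𝒳 h𝒳 E₁ hE₁
  obtain ⟨E, hE, hstep, ⟨e0⟩⟩ := hE₁
  obtain ⟨F, hF, ⟨e⟩⟩ := smoothModelExistenceVB_of_stubs stub_chowCoverFlat
    stub_directImageStructureSheaf stub_isFiniteLocallyFree_of_isVectorBundle
    stub_projectiveFlatEngine stub_frameDescent p k d 𝒳 h𝒳 E hE hstep
  exact ⟨F, hF, ⟨(Scheme.Modules.pullbackCongr (specialFibreToThickening_ι 𝒳 0).symm).app F ≪≫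
    (Scheme.Modules.pullbackComp (specialFibreToThickening 𝒳 0) (thickeningι 𝒳 1)).symm.app F ≪≫
    (Scheme.Modules.pullback (specialFibreToThickening 𝒳 0)).mapIso e ≪≫ e0⟩⟩

end Summit.HodgeConjecture.HodgeConjecture.Cruxes.FormalVectorBundlesAlgebraize.ChowFrameDescent

end
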